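import Mathlib
import Summits.ValiantsHypothesis.ValiantsHypothesis.Theorems.LiouvilleSarnakAlignedCutRank
import Summits.ValiantsHypothesis.ValiantsHypothesis.Theorems.LiouvilleSarnakLiouvilleCutRankBoundedChanges
import Summits.ValiantsHypothesis.ValiantsHypothesis.Theorems.LiouvilleSarnakLiouvilleCutRankCutTranspose
import Literature.Computability.AlgebraicComplexity.BooleanGadgets
import HarnessLib

/-!
# Route LiouvilleSarnak — crux `LiouvilleCutRank` (stmt-ValiantsHypothesis-14775):
# SCATTERED `CR` BLOCKS — the crux reduces to ONE explicit matrix family with arbitrary gaps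

The census of the item (leafhand-2 g0–g6, leafhand-3, leafhand-4 g0–g1, this hand) left as the residual class of
the OPEN crux `LiouvilleCutRank` the balanced cut words with unboundedly many letter changes and no near-periodic
window (Thue–Morse / random type): `…BoundedChanges.le_rank_of_changes_le` settles every word with `≤ K` changes,
and the window theorems (`…DefectiveTarget`, `…PeriodicDigits`, …) need a structured factor.  This file observes
that a word with MANY changes always offers one explicit minor, whatever the positions of the changes are, and
thereby reduces the crux to a statement about ONE matrix family indexed by gap sequences:

* §2 ★ `rank_blocks_le_rank` — if the cut word has factors `CR` at positions `k 0 < k 1 < ⋯ < k (t-1)` (column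
  letter at `k i`, row letter at `k i + 1`; automatically `k i + 2 ≤ k (i+1)`), then freezing the positions below
  `p ≤ k 0` to `1`, putting row bit `x i` at `k i + 1`, column bit `y i` at `k i`, and `0` elsewhere gives
  `N + 1 = 2^p · (1 + Σ_i (2 x_i + y_i) 2^{k i - p})`, so by `λ(2^p m) = (-1)^p λ(m)` the cut matrix `M_π` contains
  `±` the `2^t × 2^t` SCATTERED-BLOCK MATRIX `A_g(x, y) = λ(1 + Σ_i (2 x_i + y_i) 2^{g i})`, `g i = k i - p`:
  `rank A_g ≤ rank M_π` (§1 is the digit arithmetic: `ofBits_blocks`, `ofBits_prefix_ones`).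
* §3 ★ `le_rank_of_changes_ge` — at EVERY level: if every normalised gap sequence `0 = g 0 < ⋯ < g t` (gaps `≥ 2`)
  has `rank A_g ≥ W`, then every cut with `≥ 2t + 1` letter changes has rank `≥ W` (`t + 1` factors `CR`, or `t + 1`
  factors `RC` = factors `CR` of the swapped cut, whose matrix is the transpose, `…CutTranspose.rank_cutMatrix_swap`).
* §4 `liouvilleCutRank_iff_manyChanges` — the crux is its own many-changes case: `LiouvilleCutRank ⟺ ∀ W ∃ T n₁,
  ∀ n ≥ n₁`, every cut with `≥ T` letter changes has rank `≥ W` (dichotomy with `…BoundedChanges`); and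
  ★★ `liouvilleCutRank_of_scatteredBlocks` — `LiouvilleCutRank ⟸ SCATTERED-BLOCK HYPOTHESIS`
  `∀ W ∃ t ∀ g` (normalised, gaps `≥ 2`), `rank (λ(1 + Σ_{i ≤ t} (2 x_i + y_i) 2^{g i}))_{x, y ∈ {0,1}^{t+1}} ≥ W`.

Placement.  `g i = 2i` is the interleaved prototype `(CR)^{t+1}` (`…InterleavedUnbounded`: rank → ∞, via
`λ(4m) = λ(m)`, `λ(3m) = -λ(m)`); bounded gaps with long constant stretches fall under the window theorems; the new
content is that the gap sequence may be ARBITRARY (irregular, unbounded) — exactly what Thue–Morse-type and random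
words produce — and that nothing else about the word is needed.  The hypothesis is a statement about `λ` on the
`4^{t+1}` integers with binary digit PAIRS `x_i y_i` at prescribed positions `g i + 1, g i`: a sparse digital
analogue of the interleaved matrix, with the self-similarity `N ↦ 4N + d` replaced by independent scales `2^{g i}`.
Honest framing: a reduction and a dichotomy, not a proof — whether `rank A_g → ∞` uniformly in the gaps is open (for
two blocks already `rank A_g ≥ 2` asks for the sign of `λ(1 + 2^g) λ(3 + 2^g)`-type products); `LiouvilleCutRank`,
`DigitalBilinearLiouville`, `AlgebraicSarnak` stay OPEN; nothing bears on `VP ≠ VNP`.  No definitions.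
-/

set_option linter.dupNamespace false

noncomputable section

namespace Summit.ValiantsHypothesis.ValiantsHypothesis.Theorems.LiouvilleSarnakLiouvilleCutRank.ScatteredBlocks

open ArithmeticFunction Finset

open Summit.ValiantsHypothesis.ValiantsHypothesis.Theorems.LiouvilleSarnakAligned (liouville_two_pow_mul)
open Literature.Computability.AlgebraicComplexity.BoolGadgets (ofBits_eq_sum)
open Summit.ValiantsHypothesis.ValiantsHypothesis.Theorems.LiouvilleSarnakLiouvilleCutRank.BoundedChanges
  (le_rank_of_changes_le)
open Summit.ValiantsHypothesis.ValiantsHypothesis.Theorems.LiouvilleSarnakLiouvilleCutRank.CutTranspose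
  (rank_cutMatrix_swap)
open Summit.ValiantsHypothesis.ValiantsHypothesis.Theses.LiouvilleSarnak (LiouvilleCutRank)

/-! ### §1 Digit arithmetic of scattered blocks -/

/-- For block positions `g i` (`g i + 2 ≤ g j` for `i < j`, all `g i + 1 < L`) and bits `x y : Fin t → Bool`, the
number whose binary digits on `[0, L)` are `x i` at position `g i + 1` and `y i` at position `g i` (zero elsewhere)
is `Σ_i (2 x_i + y_i) 2^{g i}`. [folklore] -/
theorem ofBits_blocks (L t : ℕ) (g : Fin t → ℕ) (hg : ∀ i j : Fin t, i < j → g i + 2 ≤ g j)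
    (hL : ∀ i, g i + 1 < L) (x y : Fin t → Bool) :
    Nat.ofBits (fun q : Fin L => decide (∃ i : Fin t, (q : ℕ) = g i + 1 ∧ x i = true) ||
        decide (∃ i : Fin t, (q : ℕ) = g i ∧ y i = true)) =
      ∑ i : Fin t, (2 * (x i).toNat + (y i).toNat) * 2 ^ (g i) := by
  have hginj : ∀ i j : Fin t, g i = g j → i = j := by
    intro i j h
    rcases lt_trichotomy i j with hij | hij | hij
    · have := hg i j hij; omega
    · exact hij
    · have := hg j i hij; omega
  have hne : ∀ i j : Fin t, g i + 1 ≠ g j := by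
    intro i j h
    rcases lt_trichotomy i j with hij | hij | hij
    · have := hg i j hij; omega
    · subst hij; omega
    · have := hg j i hij; omega
  rw [ofBits_eq_sum]
  -- split the digit stream into its two disjoint parts
  have hsplit : ∀ q : Fin L,
      (decide (∃ i : Fin t, (q : ℕ) = g i + 1 ∧ x i = true) ||
        decide (∃ i : Fin t, (q : ℕ) = g i ∧ y i = true)).toNat * 2 ^ (q : ℕ) =
      (if ∃ i : Fin t, (q : ℕ) = g i + 1 ∧ x i = true then 2 ^ (q : ℕ) else 0) +
      (if ∃ i : Fin t, (q : ℕ) = g i ∧ y i = true then 2 ^ (q : ℕ) else 0) := by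
    intro q
    by_cases h1 : ∃ i : Fin t, (q : ℕ) = g i + 1 ∧ x i = true
    · have h2 : ¬ ∃ i : Fin t, (q : ℕ) = g i ∧ y i = true := by
        rintro ⟨j, hj, -⟩; obtain ⟨i, hi, -⟩ := h1; exact hne i j (by omega)
      rw [if_pos h1, if_neg h2, decide_eq_true h1, decide_eq_false h2]; simp
    · by_cases h2 : ∃ i : Fin t, (q : ℕ) = g i ∧ y i = true
      · rw [if_neg h1, if_pos h2, decide_eq_false h1, decide_eq_true h2]; simp
      · rw [if_neg h1, if_neg h2, decide_eq_false h1, decide_eq_false h2]; simp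
  rw [Finset.sum_congr rfl (fun q _ => hsplit q), Finset.sum_add_distrib]
  -- each part is re-indexed by the blocks
  have hpart : ∀ (s : ℕ), s ≤ 1 → ∀ z : Fin t → Bool,
      (∑ q : Fin L, if ∃ i : Fin t, (q : ℕ) = g i + s ∧ z i = true then 2 ^ (q : ℕ) else 0) =
      ∑ i : Fin t, (z i).toNat * 2 ^ (g i + s) := by
    intro s hs z
    let e : Fin t → Fin L := fun i => ⟨g i + s, by have := hL i; omega⟩
    have he : Function.Injective e := by
      intro i j h
      have : g i + s = g j + s := by simpa [e] using congrArg Fin.val h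
      exact hginj i j (by omega)
    have h1 : ∑ i : Fin t, (z i).toNat * 2 ^ (g i + s) =
        ∑ q ∈ (Finset.univ : Finset (Fin t)).image e,
          (if ∃ i : Fin t, (q : ℕ) = g i + s ∧ z i = true then 2 ^ (q : ℕ) else 0) := by
      rw [Finset.sum_image (fun i _ j _ h => he h)]
      refine Finset.sum_congr rfl (fun i _ => ?_)
      have hiff : (∃ j : Fin t, ((e i : Fin L) : ℕ) = g j + s ∧ z j = true) ↔ z i = true := by
        constructor
        · rintro ⟨j, hj, hz⟩
          have hij : i = j := hginj i j (by simpa [e] using hj)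
          subst hij; exact hz
        · intro hz; exact ⟨i, rfl, hz⟩
      rw [if_congr hiff rfl rfl]
      cases z i <;> simp [e]
    rw [h1]
    symm
    apply Finset.sum_subset (Finset.subset_univ _)
    intro q _ hq
    rw [if_neg]
    rintro ⟨i, hi, -⟩
    exact hq (Finset.mem_image.mpr ⟨i, Finset.mem_univ _, Fin.ext (by simp [e, hi])⟩)
  have hy := hpart 0 (Nat.zero_le _) y
  simp only [add_zero] at hy
  rw [hpart 1 le_rfl x, hy, ← Finset.sum_add_distrib]
  refine Finset.sum_congr rfl (fun i _ => ?_)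
  ring

/-- Freezing the bits below `p ≤ N` to `1`: if the digit at position `j < p` is `1` and the digit at `j ≥ p` is
`z (j - p)`, the number `N'` with these `N` digits satisfies `N' + 1 = 2^p · (Nat.ofBits (z on N - p digits) + 1)`.
[folklore] -/
theorem ofBits_prefix_ones (N p : ℕ) (hp : p ≤ N) (z : ℕ → Bool) :
    Nat.ofBits (fun j : Fin N => if (j : ℕ) < p then true else z ((j : ℕ) - p)) + 1 =
      2 ^ p * (Nat.ofBits (fun q : Fin (N - p) => z q) + 1) := by
  have h1 : Nat.ofBits (fun j : Fin N => if (j : ℕ) < p then true else z ((j : ℕ) - p)) =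
      2 ^ p * Nat.ofBits (fun q : Fin (N - p) => z q) + (2 ^ p - 1) := by
    apply Nat.eq_of_testBit_eq
    intro i
    rw [Nat.testBit_ofBits,
      Nat.testBit_two_pow_mul_add _ (Nat.sub_lt (Nat.two_pow_pos p) Nat.one_pos),
      Nat.testBit_two_pow_sub_one, Nat.testBit_ofBits]
    split_ifs <;> simp_all <;> omega
  rw [h1, Nat.mul_add, mul_one, Nat.add_assoc, Nat.sub_add_cancel Nat.one_le_two_pow]

/-! ### §2 The scattered-block minor of a cut matrix -/

/-- ★ **Scattered `CR` blocks give a minor.**  Let `π` be a cut of the `2n` positions with row/column word `w`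
(`w j = true` iff `j` is a row position), `p ≤ 2n`, and `k : Fin t → ℕ` block positions with `p ≤ k i`,
`k i + 1 < 2n`, `w (k i) = C`, `w (k i + 1) = R`, and `k i + 2 ≤ k j` for `i < j`.  Freezing every position below
`p` to `1`, putting the row bit `x i` at `k i + 1` and the column bit `y i` at `k i`, and `0` elsewhere, the cut
number is `N + 1 = 2^p (1 + Σ_i (2 x_i + y_i) 2^{k i - p})`, so `M_π` contains `±` the `2^t × 2^t` matrix
`(λ(1 + Σ_i (2 x_i + y_i) 2^{k i - p}))_{x,y}`; in particular its rank is at most `rank M_π`. [this file] -/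
theorem rank_blocks_le_rank (n t p : ℕ) (π : Fin n ⊕ Fin n ≃ Fin (2 * n)) (w : ℕ → Bool)
    (hw : ∀ j : Fin (2 * n), w j = (π.symm j).isLeft) (hp : p ≤ 2 * n) (k : Fin t → ℕ)
    (hpk : ∀ i, p ≤ k i) (hkn : ∀ i, k i + 1 < 2 * n)
    (hcol : ∀ i, w (k i) = false) (hrow : ∀ i, w (k i + 1) = true)
    (hgap : ∀ i j : Fin t, i < j → k i + 2 ≤ k j) :
    (Matrix.of fun x y : Fin t → Bool =>
        (((liouville ((∑ i : Fin t, (2 * (x i).toNat + (y i).toNat) * 2 ^ (k i - p)) + 1) : ℤ) : ℂ))).rank ≤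
      (Matrix.of fun r c : Fin n → Bool =>
        (((liouville (Nat.ofBits (fun j : Fin (2 * n) => Sum.elim r c (π.symm j)) + 1) : ℤ) : ℂ))).rank := by
  set M := (Matrix.of fun r c : Fin n → Bool =>
      (((liouville (Nat.ofBits (fun j : Fin (2 * n) => Sum.elim r c (π.symm j)) + 1) : ℤ) : ℂ))) with hM
  set A := (Matrix.of fun x y : Fin t → Bool =>
      (((liouville ((∑ i : Fin t, (2 * (x i).toNat + (y i).toNat) * 2 ^ (k i - p)) + 1) : ℤ) : ℂ))) with hA
  -- the local digit stream of the blocks (relative to `p`) and the row / column embeddings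
  let z : (Fin t → Bool) → (Fin t → Bool) → ℕ → Bool := fun x y q =>
    decide (∃ i : Fin t, q = (k i - p) + 1 ∧ x i = true) || decide (∃ i : Fin t, q = (k i - p) ∧ y i = true)
  let ρ : (Fin t → Bool) → (Fin n → Bool) := fun x i =>
    if (π (Sum.inl i) : ℕ) < p then true
    else decide (∃ i' : Fin t, (π (Sum.inl i) : ℕ) = k i' + 1 ∧ x i' = true)
  let γ : (Fin t → Bool) → (Fin n → Bool) := fun y i =>
    if (π (Sum.inr i) : ℕ) < p then true
    else decide (∃ i' : Fin t, (π (Sum.inr i) : ℕ) = k i' ∧ y i' = true)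
  -- (1) the global bit vector at `(ρ x, γ y)`: ones below `p`, the block stream above
  have hglob : ∀ x y (j : Fin (2 * n)), Sum.elim (ρ x) (γ y) (π.symm j) =
      (if (j : ℕ) < p then true else z x y ((j : ℕ) - p)) := by
    intro x y j
    rcases hj : π.symm j with i | i
    · have hji : π (Sum.inl i) = j := by rw [← hj, Equiv.apply_symm_apply]
      have hwj : w j = true := by rw [hw j, hj]; rfl
      rw [Sum.elim_inl]
      show (if (π (Sum.inl i) : ℕ) < p then true
        else decide (∃ i' : Fin t, (π (Sum.inl i) : ℕ) = k i' + 1 ∧ x i' = true)) = _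
      rw [hji]
      by_cases h1 : (j : ℕ) < p
      · rw [if_pos h1, if_pos h1]
      · rw [if_neg h1, if_neg h1]
        have hno : ¬ ∃ i' : Fin t, (j : ℕ) - p = k i' - p ∧ y i' = true := by
          rintro ⟨i', hi', -⟩
          have hjk : (j : ℕ) = k i' := by have := hpk i'; omega
          rw [hjk, hcol] at hwj
          exact Bool.false_ne_true hwj
        have hiff : (∃ i' : Fin t, (j : ℕ) - p = k i' - p + 1 ∧ x i' = true) ↔
            (∃ i' : Fin t, (j : ℕ) = k i' + 1 ∧ x i' = true) := by
          constructor
          · rintro ⟨i', hi', hx⟩; exact ⟨i', by have := hpk i'; omega, hx⟩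
          · rintro ⟨i', hi', hx⟩; exact ⟨i', by have := hpk i'; omega, hx⟩
        show _ = (decide (∃ i' : Fin t, (j : ℕ) - p = k i' - p + 1 ∧ x i' = true) ||
          decide (∃ i' : Fin t, (j : ℕ) - p = k i' - p ∧ y i' = true))
        rw [decide_eq_false hno, Bool.or_false]
        exact (Bool.decide_congr hiff).symm
    · have hji : π (Sum.inr i) = j := by rw [← hj, Equiv.apply_symm_apply]
      have hwj : w j = false := by rw [hw j, hj]; rfl
      rw [Sum.elim_inr]
      show (if (π (Sum.inr i) : ℕ) < p then true
        else decide (∃ i' : Fin t, (π (Sum.inr i) : ℕ) = k i' ∧ y i' = true)) = _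
      rw [hji]
      by_cases h1 : (j : ℕ) < p
      · rw [if_pos h1, if_pos h1]
      · rw [if_neg h1, if_neg h1]
        have hno : ¬ ∃ i' : Fin t, (j : ℕ) - p = k i' - p + 1 ∧ x i' = true := by
          rintro ⟨i', hi', -⟩
          have hjk : (j : ℕ) = k i' + 1 := by have := hpk i'; omega
          rw [hjk, hrow] at hwj
          exact Bool.noConfusion hwj
        have hiff : (∃ i' : Fin t, (j : ℕ) - p = k i' - p ∧ y i' = true) ↔
            (∃ i' : Fin t, (j : ℕ) = k i' ∧ y i' = true) := by
          constructor
          · rintro ⟨i', hi', hy⟩; exact ⟨i', by have := hpk i'; omega, hy⟩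
          · rintro ⟨i', hi', hy⟩; exact ⟨i', by have := hpk i'; omega, hy⟩
        show _ = (decide (∃ i' : Fin t, (j : ℕ) - p = k i' - p + 1 ∧ x i' = true) ||
          decide (∃ i' : Fin t, (j : ℕ) - p = k i' - p ∧ y i' = true))
        rw [decide_eq_false hno, Bool.false_or]
        exact (Bool.decide_congr hiff).symm
  -- (2) the cut number: `N + 1 = 2^p (V + 1)` with `V = Σ_i (2 x_i + y_i) 2^{k i - p}`
  have hnum : ∀ x y, Nat.ofBits (fun j : Fin (2 * n) => Sum.elim (ρ x) (γ y) (π.symm j)) + 1 =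
      2 ^ p * ((∑ i : Fin t, (2 * (x i).toNat + (y i).toNat) * 2 ^ (k i - p)) + 1) := by
    intro x y
    have hfun : (fun j : Fin (2 * n) => Sum.elim (ρ x) (γ y) (π.symm j)) =
        fun j : Fin (2 * n) => if (j : ℕ) < p then true else z x y ((j : ℕ) - p) :=
      funext (hglob x y)
    rw [hfun, ofBits_prefix_ones (2 * n) p hp (z x y)]
    congr 2
    exact ofBits_blocks (2 * n - p) t (fun i => k i - p)
      (by intro i j hij; have := hgap i j hij; have := hpk i; omega)
      (by intro i; have := hkn i; have := hpk i; omega) x y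
  -- (3) entries of the submatrix
  have hentry : ∀ x y, M (ρ x) (γ y) = (-1 : ℂ) ^ p * A x y := by
    intro x y
    simp only [hM, hA, Matrix.of_apply]
    rw [hnum x y, liouville_two_pow_mul]
    push_cast
    ring
  -- (4) the submatrix is `(-1)^p • A`
  have hsub : M.submatrix ρ γ = ((-1 : ℂ) ^ p) • A := by
    ext x y
    simp only [Matrix.submatrix_apply, Matrix.smul_apply, smul_eq_mul]
    exact hentry x y
  have hAeq : A = ((-1 : ℂ) ^ p) • M.submatrix ρ γ := by
    rw [hsub, smul_smul, ← mul_pow, neg_one_mul, neg_neg, one_pow, one_smul]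
  calc A.rank = (((-1 : ℂ) ^ p) • M.submatrix ρ γ).rank := by rw [← hAeq]
    _ = (Matrix.diagonal (fun _ : Fin t → Bool => (-1 : ℂ) ^ p) * M.submatrix ρ γ).rank := by
        rw [Matrix.smul_eq_diagonal_mul]
    _ ≤ (M.submatrix ρ γ).rank := Matrix.rank_mul_le_right _ _
    _ ≤ M.rank := Matrix.rank_submatrix_le M ρ γ

/-! ### §3 Many letter changes from scattered blocks, at every level -/

/-- ★ **Scattered blocks ⟹ many letter changes suffice, at EVERY level.**  Suppose every normalised configuration of
`t + 1` blocks `g : Fin (t+1) → ℕ` (`g 0 = 0`, `g i + 2 ≤ g j` for `i < j`) has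
`rank (λ(1 + Σ_i (2 x_i + y_i) 2^{g i}))_{x, y ∈ {0,1}^{t+1}} ≥ W`.  Then at every level `n`, every cut whose
row/column word has at least `2t + 1` letter changes has `rank M_π ≥ W`: more than `2t` changes contain `t + 1`
factors `CR` or `t + 1` factors `RC`; the first case is the minor of §2 at `p = k 0` (the smallest occurrence), the
second is the first case for the swapped cut `π ∘ swap`, whose matrix is the transpose (`…CutTranspose`). [this file] -/
theorem le_rank_of_changes_ge (W t : ℕ)
    (ht : ∀ g : Fin (t + 1) → ℕ, g 0 = 0 → (∀ i j : Fin (t + 1), i < j → g i + 2 ≤ g j) →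
      W ≤ (Matrix.of fun x y : Fin (t + 1) → Bool =>
        (((liouville ((∑ i : Fin (t + 1), (2 * (x i).toNat + (y i).toNat) * 2 ^ (g i)) + 1) : ℤ) :
          ℂ))).rank)
    (n : ℕ) (π : Fin n ⊕ Fin n ≃ Fin (2 * n)) (w : ℕ → Bool)
    (hw : ∀ j : Fin (2 * n), w j = (π.symm j).isLeft)
    (hch : 2 * t + 1 ≤ ((range (2 * n - 1)).filter fun j => w j ≠ w (j + 1)).card) :
    W ≤ (Matrix.of fun r c : Fin n → Bool =>
      (((liouville (Nat.ofBits (fun j : Fin (2 * n) => Sum.elim r c (π.symm j)) + 1) : ℤ) : ℂ))).rank := by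
  classical
  -- generic step: `t + 1` factors `CR` in the word of a cut force rank `≥ W`
  have hstep : ∀ (π' : Fin n ⊕ Fin n ≃ Fin (2 * n)) (w' : ℕ → Bool),
      (∀ j : Fin (2 * n), w' j = (π'.symm j).isLeft) →
      t + 1 ≤ ((range (2 * n - 1)).filter fun j => w' j = false ∧ w' (j + 1) = true).card →
      W ≤ (Matrix.of fun r c : Fin n → Bool =>
        (((liouville (Nat.ofBits (fun j : Fin (2 * n) => Sum.elim r c (π'.symm j)) + 1) : ℤ) :
          ℂ))).rank := by
    intro π' w' hw' hcard
    obtain ⟨S, hSsub, hScard⟩ := Finset.exists_subset_card_eq hcard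
    let k : Fin (t + 1) → ℕ := fun i => S.orderEmbOfFin hScard i
    have hkS : ∀ i, k i ∈ S := fun i => Finset.orderEmbOfFin_mem S hScard i
    have hkmono : StrictMono k := (S.orderEmbOfFin hScard).strictMono
    have hkprop : ∀ i, k i < 2 * n - 1 ∧ w' (k i) = false ∧ w' (k i + 1) = true := by
      intro i
      have hmem := hSsub (hkS i)
      simpa [mem_filter, mem_range] using hmem
    have hgap : ∀ i j : Fin (t + 1), i < j → k i + 2 ≤ k j := by
      intro i j hij
      have hlt : k i < k j := hkmono hij
      by_contra hcon
      have heq : k j = k i + 1 := by omega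
      have h1 := (hkprop i).2.2
      have h2 := (hkprop j).2.1
      rw [heq, h1] at h2
      exact Bool.noConfusion h2
    have hk0 : ∀ i, k 0 ≤ k i := fun i => hkmono.monotone (Fin.zero_le i)
    have hle := rank_blocks_le_rank n (t + 1) (k 0) π' w' hw' (by have := (hkprop 0).1; omega) k hk0
      (fun i => by have := (hkprop i).1; omega) (fun i => (hkprop i).2.1) (fun i => (hkprop i).2.2) hgap
    have hW := ht (fun i => k i - k 0) (by simp)
      (by intro i j hij; have := hgap i j hij; have := hk0 i; omega)
    exact hW.trans hle
  -- split the letter changes into the two orientations `CR` / `RC`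
  have hsub : ((range (2 * n - 1)).filter fun j => w j ≠ w (j + 1)) ⊆
      ((range (2 * n - 1)).filter fun j => w j = false ∧ w (j + 1) = true) ∪
      ((range (2 * n - 1)).filter fun j => w j = true ∧ w (j + 1) = false) := by
    intro j hj
    rw [mem_filter] at hj
    rw [mem_union, mem_filter, mem_filter]
    rcases hj with ⟨hjr, hne⟩
    cases h0 : w j <;> cases h1 : w (j + 1) <;> simp_all
  have hcard := hch.trans ((card_le_card hsub).trans (card_union_le _ _))
  by_cases hCR : t + 1 ≤ ((range (2 * n - 1)).filter fun j => w j = false ∧ w (j + 1) = true).card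
  · exact hstep π w hw hCR
  · -- `t + 1` factors `RC`: they are factors `CR` of the swapped cut
    have hRC : t + 1 ≤ ((range (2 * n - 1)).filter fun j => w j = true ∧ w (j + 1) = false).card := by
      omega
    have hw' : ∀ j : Fin (2 * n), (!w j) = (((Equiv.sumComm (Fin n) (Fin n)).trans π).symm j).isLeft := by
      intro j
      rw [hw j]
      show (!(π.symm j).isLeft) = (Sum.swap (π.symm j)).isLeft
      cases π.symm j <;> rfl
    have hfilter : ((range (2 * n - 1)).filter fun j => (!w j) = false ∧ (!w (j + 1)) = true) =
        ((range (2 * n - 1)).filter fun j => w j = true ∧ w (j + 1) = false) := by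
      refine Finset.filter_congr (fun j _ => ?_)
      cases w j <;> cases w (j + 1) <;> simp
    have h := hstep ((Equiv.sumComm (Fin n) (Fin n)).trans π) (fun j => !w j) hw' (by rw [hfilter]; exact hRC)
    rwa [rank_cutMatrix_swap] at h

/-! ### §4 The crux from scattered blocks -/

/-- **The crux is its own many-changes case** (dichotomy with `…BoundedChanges.le_rank_of_changes_le`):
`LiouvilleCutRank` holds iff for every `W` there are `T, n₁` such that at every level `n ≥ n₁` every cut with at
least `T` letter changes in its row/column word has rank `≥ W` (cuts with `< T` changes are covered by the
bounded-changes class). [this file] -/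
theorem liouvilleCutRank_iff_manyChanges :
    LiouvilleCutRank ↔
      ∀ W : ℕ, ∃ T n₁ : ℕ, ∀ n : ℕ, n₁ ≤ n → ∀ (π : Fin n ⊕ Fin n ≃ Fin (2 * n)) (w : ℕ → Bool),
        (∀ j : Fin (2 * n), w j = (π.symm j).isLeft) →
        T ≤ ((range (2 * n - 1)).filter fun j => w j ≠ w (j + 1)).card →
        W ≤ (Matrix.of fun r c : Fin n → Bool =>
          (((liouville (Nat.ofBits (fun j : Fin (2 * n) => Sum.elim r c (π.symm j)) + 1) : ℤ) : ℂ))).rank := by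
  constructor
  · intro h W
    obtain ⟨n₀, hn₀⟩ := h W
    exact ⟨0, n₀, fun n hn π w _ _ => hn₀ n hn π⟩
  · intro h W
    obtain ⟨T, n₁, hT⟩ := h W
    obtain ⟨n₀, hn₀⟩ := le_rank_of_changes_le T W
    refine ⟨max n₀ n₁, fun n hn π => ?_⟩
    let w : ℕ → Bool := fun j => if hj : j < 2 * n then (π.symm ⟨j, hj⟩).isLeft else false
    have hw : ∀ j : Fin (2 * n), w j = (π.symm j).isLeft := by
      intro j; simp [w, j.isLt]
    by_cases hch : ((range (2 * n - 1)).filter fun j => w j ≠ w (j + 1)).card ≤ T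
    · exact hn₀ n (le_of_max_le_left hn) π w hw hch
    · exact hT n (le_of_max_le_right hn) π w hw (by omega)

/-- ★★ **`LiouvilleCutRank` from SCATTERED BLOCKS.**  If for every `W` there is `t` such that EVERY normalised
configuration of `t + 1` blocks `0 = g 0 < g 1 < ⋯ < g t` with gaps `≥ 2` has
`rank (λ(1 + Σ_{i ≤ t} (2 x_i + y_i) 2^{g i}))_{x, y ∈ {0,1}^{t+1}} ≥ W` — the Liouville function on the `4^{t+1}`
numbers with binary digit PAIRS `(x_i y_i)` at the positions `g i + 1, g i` and zeros elsewhere, cut into the high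
bit of each pair (rows) against the low bit (columns) — then `LiouvilleCutRank` holds: at level `n ≥ n₀(2t, W)` of
`…BoundedChanges` a cut has either `≤ 2t` letter changes (bounded-changes class) or `≥ 2t + 1` (§3).  The gap
sequence is ARBITRARY: `g i = 2i` is the interleaved prototype `(CR)^{t+1}` (`…InterleavedUnbounded`), consecutive
runs of gap `2` are the `(CR)^L` windows of `…DefectiveTarget`; unbounded / irregular gaps (Thue–Morse, random
words) are the open residual of the crux, now ONE explicit matrix family. [this file] -/
theorem liouvilleCutRank_of_scatteredBlocks
    (h : ∀ W : ℕ, ∃ t : ℕ, ∀ g : Fin (t + 1) → ℕ, g 0 = 0 → (∀ i j : Fin (t + 1), i < j → g i + 2 ≤ g j) →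
      W ≤ (Matrix.of fun x y : Fin (t + 1) → Bool =>
        (((liouville ((∑ i : Fin (t + 1), (2 * (x i).toNat + (y i).toNat) * 2 ^ (g i)) + 1) : ℤ) :
          ℂ))).rank) :
    LiouvilleCutRank := by
  rw [liouvilleCutRank_iff_manyChanges]
  intro W
  obtain ⟨t, ht⟩ := h W
  exact ⟨2 * t + 1, 0, fun n _ π w hw hch => le_rank_of_changes_ge W t ht n π w hw hch⟩

end Summit.ValiantsHypothesis.ValiantsHypothesis.Theorems.LiouvilleSarnakLiouvilleCutRank.ScatteredBlocks

end
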